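import Summits.Parity.GeneralizedHardyLittlewood.Theses.LiouvilleOpening

/-!
# Birth skeleton (BC3) — crux stmt-Parity-16149 `Theses.LiouvilleOpening.ChowlaNatural` (rank 4)
# line `birth`: complete multiplicativity normalises EVERY pair system to a pure two-point
# λ-correlation with equal dilations — TWIN shape `λ(qm+h₁)λ(qm+h₂)` or GOLDBACH shape `λ(qm+h₁)λ(h₂−qm)`

Registered by the skeleton registrar (planner one-shot `planner-skel-stmt-Parity-16149-0`,
2026-08-17; BC3 of `run/shared/lean/lens3/_common/BC.md`). Route `route-Parity-LiouvilleOpening`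
(the crux is the route's ENTIRE parity input; it is also wanted by `route-Parity-PolynomialKatai`).
Two NAMED stubs and the kernel-checked composition `ChowlaNatural_of` concluding the crux BY NAME;
`chowlaNatural_of_stubs` plugs the stubs in.

## The crux (FIXED; verbatim the route decl)

`ChowlaNatural`: for every `L` and `ε > 0`, eventually in `N`, uniformly over non-degenerate pair
systems `Ψ = (ψ₁, ψ₂) : Fin 2 → AffLinForm 1` with `‖Ψ‖_N ≤ L` (so `|aᵢ| ≤ L`, `|bᵢ| ≤ L N` for
`ψᵢ(m) = aᵢ m + bᵢ`) and convex `K ⊆ [−N, N]`: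
`|∑_{m ∈ K ∩ ℤ} λ(ψ₁(m)) λ(ψ₂(m))| ≤ ε N` (`λ` of a non-positive value is `λ(0) = 0` via `Int.toNat`).

## The cut — the route's own lever (complete multiplicativity of λ), applied to the crux itself

For `k ≥ 1`, `λ(k)² = 1` and `λ(k x) = λ(k) λ(x)` (through `Int.toNat`: both sides vanish for
`x ≤ 0`). Hence for a pair system with `a₁ > 0` (after the reflection `m ↦ −m` if `a₁ < 0`) and
`α = |a₂|`, `q = a₁ α ≤ L²`:
`λ(a₁m+b₁) λ(a₂m+b₂) = λ(α)λ(a₁) · λ(qm + αb₁) · λ(±qm + a₁b₂)` with the sign of `a₂`.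
So the crux's sum over the integer points of `K` (an integer interval `[u, v] ⊆ [−N, N]`, since a
convex subset of `ℝ¹` is order-connected) is, up to a sign, an EQUAL-DILATION two-point
λ-correlation with modulus `q ≤ L²` and shifts `|hᵢ| ≤ L² N`; non-degeneracy `a₁b₂ ≠ a₂b₁` is
exactly `h₁ ≠ h₂` in the twin shape. The two shapes are genuinely different statements
(`λ(n)λ(n+h)` versus `λ(n)λ(M−n)`: the Goldbach shape has no shift structure to average in `n`):

* `stub_twinShape` (T, OPEN — natural-density two-point Chowla in a progression, shift-uniform):
  for every `L`, `ε > 0`, eventually in `N`: for `1 ≤ q ≤ L`, `h₁ ≠ h₂` with `|hᵢ| ≤ L N` and every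
  `[u, v] ⊆ [−N, N]`, `|∑_{m=u}^{v} λ(qm+h₁) λ(qm+h₂)| ≤ ε N`. Writing `n = qm + h₁` this is
  `∑_{n ∈ I, n ≡ h₁ (q)} λ(n) λ(n+h) = o(N)` with `h = h₂ − h₁ ≠ 0`, `|h| ≤ 2LN`: Chowla's two-point
  conjecture for λ at NATURAL density, restricted to a residue class of bounded modulus, uniform in
  the shift up to the length scale. Known: logarithmically averaged (Tao 2016, tree fact
  `tao_log_chowla_liouville`), at almost all scales (Tao–Teräväinen 2019), on average over
  `|h| ≤ H`, `H → ∞` (Matomäki–Radziwiłł–Tao 2015). It is the `a₁ = a₂ = q` special case of the crux.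
  Why it might fail: natural density is open even for `q = 1`, `h = 1` (LogarithmicAveraging
  barrier); shift-uniformity `|h| ≤ 2LN` makes it Siegel-complete (`λ ≈ χ_exc` biases `λ(n)λ(n+q_exc)`).
* `stub_goldbachShape` (G, OPEN — the even-Goldbach problem for λ in a progression): same
  quantifiers, `|∑_{m=u}^{v} λ(qm+h₁) λ(h₂−qm)| ≤ ε N`, i.e. `∑_{n ∈ I, n ≡ h₁ (q)} λ(n) λ(M−n) = o(N)`
  uniformly for `M = h₁ + h₂ ≤ 2LN` (trivial unless `M ≫ εN`). It is the `a₁ = q = −a₂` case of the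
  crux (`h₂ = −h₁`, the degenerate system, gives an identically vanishing sum: `goldbach_degenerate`).
  Why it might fail: even the logarithmically averaged form is NOT covered by Tao's theorem (no
  shift to average along); only almost-all-`M` results are known; Siegel-complete in `M` as well.

Composition `ChowlaNatural_of : T → G → ChowlaNatural` (REAL proof, this file): lattice points of a
convex `K ⊆ [−N,N]` in `Fin 1 → ℝ` form an integer interval; unpack `‖Ψ‖_N ≤ L` and
non-degeneracy into `0 < |aᵢ| ≤ L`, `|bᵢ| ≤ LN`, `a₁b₂ ≠ a₂b₁`; reflect if `a₁ < 0`; multiply through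
by `λ(|a₂|)λ(a₁)` (complete multiplicativity through `Int.toNat`) and apply T or G at level `L²`
according to the sign of `a₂`. So the skeleton PROVES that the crux is equivalent to its two
equal-dilation shapes (the converse, crux ⇒ T ∧ G, is the coordinate special case `Ψ = (qm+h₁, ±qm+h₂)`,
`K = [u,v]`, size `≤ 4L`; not needed here).

Sanity (no `sorry`): `goldbach_degenerate` (the `h₂ = −h₁` Goldbach sum is `0`), `lam_mul_left`
(the multiplicativity-through-`toNat` identity). Neither stub gives the crux or the summit cheaply
(BC3 probes, NOTES.md of the registrar: `stub → ChowlaNatural`, `stub → GeneralizedHardyLittlewood`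
by `first | exact? | simpa | aesop` all FAIL).

Disproof.lean: none exists for this crux (`ledger crux ls stmt-Parity-16149`: no workfiles at
registration) — no `_false_without_` obligations. Negatives index (3 entries: ConvMomentLevelOne,
InverseSieveTuplesTupleElliott, RectangleChowla): none is a λ-autocorrelation statement; the
TupleElliott witness (shift `z!` against a fixed sieve exemption level) concerns Λ-main terms, absent
here. Barriers: `Literature.Barriers.Parity.LogarithmicAveraging` — NOT evaded (both stubs are
natural-density statements; that is the crux's declared bet); `SiegelZeroTwinPrimes` — declared
(shift-uniformity is inherited from the crux, split evenly between T and G); `SelbergParityBarrier`,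
`PrimePairParity`, `TrueComplexityBinary`, `CircleMethodBinaryBarrier` — not in their classes (no
sieve weights, no Gowers norms, no exponential sums: pure λ-correlations).
-/

set_option linter.dupNamespace false

noncomputable section

open scoped BigOperators Classical

namespace Summit.Parity.GeneralizedHardyLittlewood.Cruxes.ChowlaNatural.Birth

open Literature.NumberTheory.Sieve
open Summit.Parity.GeneralizedHardyLittlewood.Theses.LiouvilleOpening (ChowlaNatural)

/-! ## Legend: the two stub statements as named propositions (verbatim the registered signatures) -/

/-- Statement of `stub_twinShape` (T): equal-dilation two-point λ-correlation, twin orientation. -/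
def Sig.stub_twinShape : Prop :=
  ∀ (L : ℕ) (ε : ℝ), 0 < ε → ∃ N₀ : ℕ, ∀ N : ℕ, N₀ ≤ N → ∀ q : ℕ, 1 ≤ q → q ≤ L → ∀ h₁ h₂ : ℤ, h₁ ≠ h₂ → |h₁| ≤ (L : ℤ) * (N : ℤ) → |h₂| ≤ (L : ℤ) * (N : ℤ) → ∀ u v : ℤ, -(N : ℤ) ≤ u → v ≤ (N : ℤ) → |∑ m ∈ Finset.Icc u v, ((ArithmeticFunction.liouville (Int.toNat ((q : ℤ) * m + h₁)) : ℤ) : ℝ) * ((ArithmeticFunction.liouville (Int.toNat ((q : ℤ) * m + h₂)) : ℤ) : ℝ)| ≤ ε * (N : ℝ)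

/-- Statement of `stub_goldbachShape` (G): equal-dilation two-point λ-correlation, Goldbach
orientation. -/
def Sig.stub_goldbachShape : Prop :=
  ∀ (L : ℕ) (ε : ℝ), 0 < ε → ∃ N₀ : ℕ, ∀ N : ℕ, N₀ ≤ N → ∀ q : ℕ, 1 ≤ q → q ≤ L → ∀ h₁ h₂ : ℤ, |h₁| ≤ (L : ℤ) * (N : ℤ) → |h₂| ≤ (L : ℤ) * (N : ℤ) → ∀ u v : ℤ, -(N : ℤ) ≤ u → v ≤ (N : ℤ) → |∑ m ∈ Finset.Icc u v, ((ArithmeticFunction.liouville (Int.toNat ((q : ℤ) * m + h₁)) : ℤ) : ℝ) * ((ArithmeticFunction.liouville (Int.toNat (h₂ - (q : ℤ) * m)) : ℤ) : ℝ)| ≤ ε * (N : ℝ)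

/-! ## Registered stubs (`sorry` only here; signatures def-free and self-contained) -/

/-- **T — TWIN SHAPE: natural-density two-point Chowla for λ in a progression of bounded modulus,
shift-uniform.** For every `L` and `ε > 0` there is `N₀` such that for all `N ≥ N₀`, all moduli
`1 ≤ q ≤ L`, all shifts `h₁ ≠ h₂` with `|hᵢ| ≤ L N` and all integer intervals `[u, v] ⊆ [−N, N]`:
`|∑_{m=u}^{v} λ(qm + h₁) λ(qm + h₂)| ≤ ε N` (`λ ∘ Int.toNat`: non-positive values contribute `0`).
Equivalently `∑_{n ∈ I, n ≡ h₁ (q)} λ(n)λ(n + h) = o(N)`, `h = h₂ − h₁ ≠ 0`, `|h| ≤ 2LN`. The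
`a₁ = a₂ = q` special case of the crux. Known only log-averaged (TaoFMP2016; tree fact
`tao_log_chowla_liouville`), at almost all scales (TaoTeravainen2019), or averaged over `h`
(MatomakiRadziwillTao2015). Why it might fail: natural density open already for `q = 1, h = 1`
(Literature.Barriers.Parity.LogarithmicAveraging); shift-uniformity makes it Siegel-complete.
Sources: TaoFMP2016 (arXiv:1509.05422), TaoTeravainenDuke2019, MatomakiRadziwillTao2015,
HelfgottRadziwill2021, Pilatte2026, Chowla1965. Size: open-problem. -/
theorem stub_twinShape : ∀ (L : ℕ) (ε : ℝ), 0 < ε → ∃ N₀ : ℕ, ∀ N : ℕ, N₀ ≤ N → ∀ q : ℕ, 1 ≤ q → q ≤ L → ∀ h₁ h₂ : ℤ, h₁ ≠ h₂ → |h₁| ≤ (L : ℤ) * (N : ℤ) → |h₂| ≤ (L : ℤ) * (N : ℤ) → ∀ u v : ℤ, -(N : ℤ) ≤ u → v ≤ (N : ℤ) → |∑ m ∈ Finset.Icc u v, ((ArithmeticFunction.liouville (Int.toNat ((q : ℤ) * m + h₁)) : ℤ) : ℝ) * ((ArithmeticFunction.liouville (Int.toNat ((q : ℤ) * m + h₂))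 : ℤ) : ℝ)| ≤ ε * (N : ℝ) := by
  sorry

/-- **G — GOLDBACH SHAPE: the even-Goldbach problem for λ in a progression of bounded modulus,
uniform in the target.** For every `L` and `ε > 0` there is `N₀` such that for all `N ≥ N₀`, all
`1 ≤ q ≤ L`, all `h₁, h₂` with `|hᵢ| ≤ L N` and all `[u, v] ⊆ [−N, N]`:
`|∑_{m=u}^{v} λ(qm + h₁) λ(h₂ − qm)| ≤ ε N`, i.e. `∑_{n ∈ I, n ≡ h₁ (q)} λ(n) λ(M − n) = o(N)`
uniformly for `M = h₁ + h₂ ≤ 2LN`. The `a₁ = q = −a₂` special case of the crux (the degenerate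
`h₂ = −h₁` sum vanishes identically, `goldbach_degenerate`). Why it might fail: no logarithmic
averaging is available in this orientation (Tao's entropy decrement needs the shift structure), only
almost-all-`M` statements are known; Siegel-complete in `M`. Sources: TaoFMP2016,
TaoTeravainenDuke2019 (odd-order cases), MatomakiRadziwillTao2015, Chowla1965. Size: open-problem. -/
theorem stub_goldbachShape : ∀ (L : ℕ) (ε : ℝ), 0 < ε → ∃ N₀ : ℕ, ∀ N : ℕ, N₀ ≤ N → ∀ q : ℕ, 1 ≤ q → q ≤ L → ∀ h₁ h₂ : ℤ, |h₁| ≤ (L : ℤ) * (N : ℤ) → |h₂| ≤ (L : ℤ) * (N : ℤ) → ∀ u v : ℤ, -(N : ℤ) ≤ u → v ≤ (N : ℤ) → |∑ m ∈ Finset.Icc u v, ((ArithmeticFunction.liouville (Int.toNat ((q : ℤ) * m + h₁)) : ℤ) : ℝ) * ((ArithmeticFunction.liouville (Int.toNat (h₂ - (q : ℤ) * m)) : ℤ) : ℝ)| ≤ ε * (N : ℝ) := by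
  sorry

/-! ## In-file vocabulary for the composition (NOT used in the stub signatures) -/

/-- `λ` on `ℤ` through `Int.toNat`, real-valued — the crux's summand `((λ (Int.toNat x) : ℤ) : ℝ)`. -/
def lam (x : ℤ) : ℝ :=
  ((ArithmeticFunction.liouville (Int.toNat x) : ℤ) : ℝ)

/-- `λ` of a non-positive integer is `λ(0) = 0`. -/
theorem lam_nonpos {x : ℤ} (hx : x ≤ 0) : lam x = 0 := by
  have h : Int.toNat x = 0 := Int.toNat_eq_zero.mpr hx
  simp [lam, h]

/-- `|λ(n)| ≤ 1`. -/
theorem abs_liouville_real_le_one (n : ℕ) : |((ArithmeticFunction.liouville n : ℤ) : ℝ)| ≤ 1 := by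
  by_cases hn : n = 0
  · subst hn
    simp
  · rw [ArithmeticFunction.liouville_apply hn]
    push_cast
    simp [abs_pow]

/-- `|lam x| ≤ 1`. -/
theorem abs_lam_le_one (x : ℤ) : |lam x| ≤ 1 :=
  abs_liouville_real_le_one _

/-- `λ(k)² = 1` for `k > 0`. -/
theorem lam_mul_self {k : ℤ} (hk : 0 < k) : lam k * lam k = 1 := by
  have hk0 : Int.toNat k ≠ 0 := fun h => (not_le.mpr hk) (Int.toNat_eq_zero.mp h)
  simp only [lam]
  rw [ArithmeticFunction.liouville_apply hk0]
  push_cast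
  rw [← pow_add, ← two_mul, pow_mul]
  norm_num

/-- **Complete multiplicativity through `Int.toNat`**: `λ(kx) = λ(k) λ(x)` for `k > 0` (for `x ≤ 0`
both sides vanish). -/
theorem lam_mul_left {k : ℤ} (hk : 0 < k) (x : ℤ) : lam (k * x) = lam k * lam x := by
  by_cases hx : 0 < x
  · simp only [lam]
    rw [Int.toNat_mul hk.le hx.le, ArithmeticFunction.liouville_apply_mul, Int.cast_mul]
  · have hx' : x ≤ 0 := not_lt.mp hx
    have hkx : k * x ≤ 0 := by nlinarith
    rw [lam_nonpos hkx, lam_nonpos hx', mul_zero]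

/-- The dilation identity used to normalise the linear coefficients: `λ(x) = λ(k) λ(kx)`, `k > 0`. -/
theorem lam_eq_mul_lam_mul {k : ℤ} (hk : 0 < k) (x : ℤ) : lam x = lam k * lam (k * x) := by
  rw [lam_mul_left hk, ← mul_assoc, lam_mul_self hk, one_mul]

/-- Sanity: the degenerate Goldbach sum (`h₂ = −h₁`) vanishes identically. -/
theorem goldbach_degenerate (q h u v : ℤ) :
    ∑ m ∈ Finset.Icc u v, lam (q * m + h) * lam (-h - q * m) = 0 := by
  refine Finset.sum_eq_zero fun m _ => ?_
  rcases le_or_gt (q * m + h) 0 with h1 | h1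
  · rw [lam_nonpos h1, zero_mul]
  · rw [lam_nonpos (by linarith : -h - q * m ≤ 0), mul_zero]

/-- Sums over the filtered lattice box in dimension one are sums over an integer filter
(transport along `n ↦ n 0`). -/
theorem sum_latticeBox_one (N : ℕ) (K : Set (Fin 1 → ℝ)) (F : (Fin 1 → ℤ) → ℝ) :
    ∑ n ∈ @Finset.filter (Fin 1 → ℤ) (fun n => realPoint n ∈ K) (Classical.decPred _)
        (latticeBox 1 N), F n
      = ∑ m ∈ (Finset.Icc (-(N : ℤ)) N).filter (fun m : ℤ => (fun _ : Fin 1 => (m : ℝ)) ∈ K),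
          F (fun _ => m) := by
  refine Finset.sum_nbij' (fun n => n 0) (fun m => fun _ => m) ?_ ?_ ?_ ?_ ?_
  · intro n hn
    rw [Finset.mem_filter] at hn ⊢
    obtain ⟨hbox, hK⟩ := hn
    unfold latticeBox at hbox
    rw [Fintype.mem_piFinset] at hbox
    refine ⟨hbox 0, ?_⟩
    have hrp : realPoint n = fun _ : Fin 1 => ((n 0 : ℤ) : ℝ) := by
      funext j
      rw [Subsingleton.elim j 0]
      rfl
    rw [← hrp]
    exact hK
  · intro m hm
    rw [Finset.mem_filter] at hm ⊢
    refine ⟨?_, hm.2⟩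
    unfold latticeBox
    rw [Fintype.mem_piFinset]
    exact fun _ => hm.1
  · intro n _
    funext j
    rw [Subsingleton.elim j 0]
  · intro m _
    rfl
  · intro n _
    show F n = F (fun _ => n 0)
    congr 1
    funext j
    rw [Subsingleton.elim j 0]

/-- The integer points of a convex `K` (in `Fin 1 → ℝ`) inside `[−N, N]` form an integer interval
(or the empty set): a convex subset of the line is order-connected. -/
theorem interval_of_convex (N : ℕ) (K : Set (Fin 1 → ℝ)) (hK : Convex ℝ K) :
    (Finset.Icc (-(N : ℤ)) N).filter (fun m : ℤ => (fun _ : Fin 1 => (m : ℝ)) ∈ K) = ∅ ∨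
      ∃ u v : ℤ, -(N : ℤ) ≤ u ∧ v ≤ N ∧
        (Finset.Icc (-(N : ℤ)) N).filter (fun m : ℤ => (fun _ : Fin 1 => (m : ℝ)) ∈ K)
          = Finset.Icc u v := by
  set T := (Finset.Icc (-(N : ℤ)) N).filter (fun m : ℤ => (fun _ : Fin 1 => (m : ℝ)) ∈ K)
    with hTdef
  by_cases hT0 : T = ∅
  · exact Or.inl hT0
  right
  have hTne : T.Nonempty := Finset.nonempty_iff_ne_empty.mpr hT0
  -- the copy of `K` on the real line is convex, hence order-connected
  set K₁ : Set ℝ := {r | (fun _ : Fin 1 => r) ∈ K} with hK₁def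
  have hK₁c : Convex ℝ K₁ := hK.linear_preimage (LinearMap.pi fun _ : Fin 1 => LinearMap.id)
  have hord : K₁.OrdConnected := convex_iff_ordConnected.mp hK₁c
  have hmem : ∀ m : ℤ, m ∈ T ↔ (-(N : ℤ) ≤ m ∧ m ≤ N) ∧ (m : ℝ) ∈ K₁ := by
    intro m
    simp only [hTdef, Finset.mem_filter, Finset.mem_Icc, hK₁def, Set.mem_setOf_eq]
  have ha := (hmem _).1 (Finset.min'_mem T hTne)
  have hb := (hmem _).1 (Finset.max'_mem T hTne)
  refine ⟨T.min' hTne, T.max' hTne, ha.1.1, hb.1.2, ?_⟩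
  ext m
  constructor
  · intro hm
    exact Finset.mem_Icc.2 ⟨Finset.min'_le T m hm, Finset.le_max' T m hm⟩
  · intro hm
    rw [Finset.mem_Icc] at hm
    refine (hmem m).2 ⟨⟨le_trans ha.1.1 hm.1, le_trans hm.2 hb.1.2⟩, ?_⟩
    exact hord.out ha.2 hb.2 ⟨by exact_mod_cast hm.1, by exact_mod_cast hm.2⟩

/-- Reflection `m ↦ −m` of an integer interval. -/
theorem sum_Icc_reflect (f : ℤ → ℝ) (u v : ℤ) :
    ∑ m ∈ Finset.Icc u v, f m = ∑ m ∈ Finset.Icc (-v) (-u), f (-m) := by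
  refine Finset.sum_nbij' (fun m => -m) (fun m => -m) ?_ ?_ ?_ ?_ ?_
  · intro m hm
    rw [Finset.mem_Icc] at hm ⊢
    omega
  · intro m hm
    rw [Finset.mem_Icc] at hm ⊢
    omega
  · intro m _
    exact neg_neg m
  · intro m _
    exact neg_neg m
  · intro m _
    simp only [neg_neg]

/-- Evaluation of a one-dimensional affine-linear form: `ψ(m) = a m + b`. -/
theorem eval_fin_one (ψ : AffLinForm 1) (m : ℤ) :
    ψ.eval (fun _ : Fin 1 => m) = ψ.coeff 0 * m + ψ.const := by
  simp [AffLinForm.eval]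

/-- Evaluation of a one-dimensional affine-linear form at a general lattice point. -/
theorem eval_fin_one' (ψ : AffLinForm 1) (n : Fin 1 → ℤ) :
    ψ.eval n = ψ.coeff 0 * n 0 + ψ.const := by
  simp [AffLinForm.eval]

/-! ## The normalised estimate: `a₁ > 0`, both stubs at level `L²` -/

/-- **Core reduction** (complete multiplicativity). Assume T and G. For every `L`, `ε > 0` there is
`N₀` such that for `N ≥ N₀`, integers `a₁ > 0`, `a₂ ≠ 0` with `a₁ ≤ L`, `|a₂| ≤ L`, `|bᵢ| ≤ L N`,
`a₁ b₂ ≠ a₂ b₁`, and every `[u, v] ⊆ [−N, N]`: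
`|∑_{m=u}^{v} λ(a₁m+b₁) λ(a₂m+b₂)| ≤ ε N`. Proof: with `α = |a₂|`, `q = a₁ α ≤ L²`,
`λ(a₁m+b₁)λ(a₂m+b₂) = λ(α)λ(a₁) · λ(qm+αb₁) λ(±qm+a₁b₂)`; apply T (if `a₂ > 0`; `αb₁ ≠ a₁b₂` is
non-degeneracy) or G (if `a₂ < 0`) at level `L·L`. -/
theorem core (hT : Sig.stub_twinShape) (hG : Sig.stub_goldbachShape) (L : ℕ) {ε : ℝ}
    (hε : 0 < ε) :
    ∃ N₀ : ℕ, ∀ N : ℕ, N₀ ≤ N → ∀ a₁ b₁ a₂ b₂ : ℤ, 0 < a₁ → a₂ ≠ 0 → a₁ ≤ (L : ℤ) →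
      |a₂| ≤ (L : ℤ) → |b₁| ≤ (L : ℤ) * (N : ℤ) → |b₂| ≤ (L : ℤ) * (N : ℤ) → a₁ * b₂ ≠ a₂ * b₁ →
      ∀ u v : ℤ, -(N : ℤ) ≤ u → v ≤ (N : ℤ) →
        |∑ m ∈ Finset.Icc u v, lam (a₁ * m + b₁) * lam (a₂ * m + b₂)| ≤ ε * (N : ℝ) := by
  obtain ⟨N₁, hN₁⟩ := hT (L * L) ε hε
  obtain ⟨N₂, hN₂⟩ := hG (L * L) ε hε
  refine ⟨max N₁ N₂, ?_⟩
  intro N hN a₁ b₁ a₂ b₂ ha₁ ha₂ haL₁ haL₂ hb₁ hb₂ hdet u v hu hv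
  -- the common modulus `q = a₁ |a₂|`
  set α : ℤ := |a₂| with hαdef
  have hα : 0 < α := abs_pos.mpr ha₂
  have hαL : α ≤ (L : ℤ) := haL₂
  have hL0 : (0 : ℤ) ≤ (L : ℤ) := Int.natCast_nonneg L
  have hN0 : (0 : ℤ) ≤ (N : ℤ) := Int.natCast_nonneg N
  obtain ⟨q, hqA⟩ : ∃ q : ℕ, (q : ℤ) = a₁ * α :=
    ⟨(a₁ * α).toNat, Int.toNat_of_nonneg (mul_pos ha₁ hα).le⟩
  have hqpos : (0 : ℤ) < (q : ℤ) := by rw [hqA]; exact mul_pos ha₁ hα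
  have hq1 : 1 ≤ q := by omega
  have hqLL : (q : ℤ) ≤ ((L * L : ℕ) : ℤ) := by
    push_cast
    rw [hqA]
    exact mul_le_mul haL₁ hαL hα.le hL0
  have hqL : q ≤ L * L := by exact_mod_cast hqLL
  -- the normalised shifts
  have hh₁ : |α * b₁| ≤ ((L * L : ℕ) : ℤ) * (N : ℤ) := by
    rw [abs_mul, abs_of_pos hα]
    push_cast
    calc α * |b₁| ≤ (L : ℤ) * ((L : ℤ) * (N : ℤ)) := mul_le_mul hαL hb₁ (abs_nonneg _) hL0
      _ = (L : ℤ) * (L : ℤ) * (N : ℤ) := by ring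
  have hh₂ : |a₁ * b₂| ≤ ((L * L : ℕ) : ℤ) * (N : ℤ) := by
    rw [abs_mul, abs_of_pos ha₁]
    push_cast
    calc a₁ * |b₂| ≤ (L : ℤ) * ((L : ℤ) * (N : ℤ)) := mul_le_mul haL₁ hb₂ (abs_nonneg _) hL0
      _ = (L : ℤ) * (L : ℤ) * (N : ℤ) := by ring
  -- the sign prefactor
  have hc1 : |lam α * lam a₁| ≤ 1 := by
    rw [abs_mul]
    exact mul_le_one₀ (abs_lam_le_one α) (abs_nonneg _) (abs_lam_le_one a₁)
  rcases lt_or_gt_of_ne ha₂ with ha₂neg | ha₂pos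
  · -- GOLDBACH shape: `α = -a₂`
    have hαeq : α = -a₂ := abs_of_neg ha₂neg
    have hterm : ∀ m : ℤ, lam (a₁ * m + b₁) * lam (a₂ * m + b₂)
        = (lam α * lam a₁) * (lam ((q : ℤ) * m + α * b₁) * lam (a₁ * b₂ - (q : ℤ) * m)) := by
      intro m
      have e1 : α * (a₁ * m + b₁) = (q : ℤ) * m + α * b₁ := by rw [hqA]; ring
      have e2 : a₁ * (a₂ * m + b₂) = a₁ * b₂ - (q : ℤ) * m := by rw [hqA, hαeq]; ring
      rw [lam_eq_mul_lam_mul hα (a₁ * m + b₁), lam_eq_mul_lam_mul ha₁ (a₂ * m + b₂), e1, e2]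
      ring
    have hsum : ∑ m ∈ Finset.Icc u v, lam (a₁ * m + b₁) * lam (a₂ * m + b₂)
        = (lam α * lam a₁) *
            ∑ m ∈ Finset.Icc u v, lam ((q : ℤ) * m + α * b₁) * lam (a₁ * b₂ - (q : ℤ) * m) := by
      rw [Finset.mul_sum]
      exact Finset.sum_congr rfl fun m _ => hterm m
    have hstub := hN₂ N (le_of_max_le_right hN) q hq1 hqL (α * b₁) (a₁ * b₂) hh₁ hh₂ u v hu hv
    rw [hsum, abs_mul]
    calc |lam α * lam a₁| *
          |∑ m ∈ Finset.Icc u v, lam ((q : ℤ) * m + α * b₁) * lam (a₁ * b₂ - (q : ℤ) * m)|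
        ≤ 1 * |∑ m ∈ Finset.Icc u v, lam ((q : ℤ) * m + α * b₁) * lam (a₁ * b₂ - (q : ℤ) * m)| :=
          mul_le_mul_of_nonneg_right hc1 (abs_nonneg _)
      _ = |∑ m ∈ Finset.Icc u v, lam ((q : ℤ) * m + α * b₁) * lam (a₁ * b₂ - (q : ℤ) * m)| :=
          one_mul _
      _ ≤ ε * (N : ℝ) := hstub
  · -- TWIN shape: `α = a₂`
    have hαeq : α = a₂ := abs_of_pos ha₂pos
    have hne : α * b₁ ≠ a₁ * b₂ := by
      rw [hαeq]
      exact fun h => hdet h.symm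
    have hterm : ∀ m : ℤ, lam (a₁ * m + b₁) * lam (a₂ * m + b₂)
        = (lam α * lam a₁) * (lam ((q : ℤ) * m + α * b₁) * lam ((q : ℤ) * m + a₁ * b₂)) := by
      intro m
      have e1 : α * (a₁ * m + b₁) = (q : ℤ) * m + α * b₁ := by rw [hqA]; ring
      have e2 : a₁ * (a₂ * m + b₂) = (q : ℤ) * m + a₁ * b₂ := by rw [hqA, hαeq]; ring
      rw [lam_eq_mul_lam_mul hα (a₁ * m + b₁), lam_eq_mul_lam_mul ha₁ (a₂ * m + b₂), e1, e2]
      ring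
    have hsum : ∑ m ∈ Finset.Icc u v, lam (a₁ * m + b₁) * lam (a₂ * m + b₂)
        = (lam α * lam a₁) *
            ∑ m ∈ Finset.Icc u v, lam ((q : ℤ) * m + α * b₁) * lam ((q : ℤ) * m + a₁ * b₂) := by
      rw [Finset.mul_sum]
      exact Finset.sum_congr rfl fun m _ => hterm m
    have hstub :=
      hN₁ N (le_of_max_le_left hN) q hq1 hqL (α * b₁) (a₁ * b₂) hne hh₁ hh₂ u v hu hv
    rw [hsum, abs_mul]
    calc |lam α * lam a₁| *
          |∑ m ∈ Finset.Icc u v, lam ((q : ℤ) * m + α * b₁) * lam ((q : ℤ) * m + a₁ * b₂)|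
        ≤ 1 * |∑ m ∈ Finset.Icc u v, lam ((q : ℤ) * m + α * b₁) * lam ((q : ℤ) * m + a₁ * b₂)| :=
          mul_le_mul_of_nonneg_right hc1 (abs_nonneg _)
      _ = |∑ m ∈ Finset.Icc u v, lam ((q : ℤ) * m + α * b₁) * lam ((q : ℤ) * m + a₁ * b₂)| :=
          one_mul _
      _ ≤ ε * (N : ℝ) := hstub

/-! ## Composition: the crux BY NAME from the two stubs (real proof, no `sorry`) -/

/-- **ChowlaNatural from T and G.** Unpack the pair system into coordinates (`ψᵢ(m) = aᵢ m + bᵢ`,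
`0 < |aᵢ| ≤ L`, `|bᵢ| ≤ L N`, `a₁ b₂ ≠ a₂ b₁`), turn the lattice points of the convex `K` into an
integer interval `[u, v] ⊆ [−N, N]`, reflect if `a₁ < 0`, and apply `core`. -/
theorem ChowlaNatural_of : Sig.stub_twinShape → Sig.stub_goldbachShape → ChowlaNatural := by
  intro hT hG L ε hε
  obtain ⟨N₀, hN₀⟩ := core hT hG L hε
  refine ⟨max N₀ 1, ?_⟩
  intro N hN Ψ hΨ hL K hK hKN
  have hN₀N : N₀ ≤ N := le_of_max_le_left hN
  have hN1 : 1 ≤ N := le_of_max_le_right hN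
  have hNpos : (0 : ℝ) < (N : ℝ) := by exact_mod_cast hN1
  -- coordinates of the two forms
  obtain ⟨a₁, ha₁def⟩ : ∃ a : ℤ, (Ψ 0).coeff 0 = a := ⟨_, rfl⟩
  obtain ⟨b₁, hb₁def⟩ : ∃ b : ℤ, (Ψ 0).const = b := ⟨_, rfl⟩
  obtain ⟨a₂, ha₂def⟩ : ∃ a : ℤ, (Ψ 1).coeff 0 = a := ⟨_, rfl⟩
  obtain ⟨b₂, hb₂def⟩ : ∃ b : ℤ, (Ψ 1).const = b := ⟨_, rfl⟩
  -- non-degeneracy: `aᵢ ≠ 0` and `a₁ b₂ ≠ a₂ b₁`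
  have hcoeff : ∀ i : Fin 2, (Ψ i).coeff 0 ≠ 0 := by
    intro i h
    apply hΨ.1 i
    funext j
    rw [Subsingleton.elim j 0]
    simpa using h
  have ha₁ : a₁ ≠ 0 := by
    rw [← ha₁def]
    exact hcoeff 0
  have ha₂ : a₂ ≠ 0 := by
    rw [← ha₂def]
    exact hcoeff 1
  have hdet : a₁ * b₂ ≠ a₂ * b₁ := by
    intro h
    have hprop : ∀ n : Fin 1 → ℤ, a₂ * (Ψ 0).eval n = a₁ * (Ψ 1).eval n := by
      intro n
      rw [eval_fin_one', eval_fin_one', ha₁def, hb₁def, ha₂def, hb₂def]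
      linear_combination (-1 : ℤ) * h
    exact ha₂ (hΨ.2 0 1 (by decide) a₂ a₁ hprop).1
  -- size: `|aᵢ| ≤ L`, `|bᵢ| ≤ L N`
  have hL' := hL
  simp only [affLinSize, Fin.sum_univ_two, Fin.sum_univ_one, ha₁def, hb₁def, ha₂def, hb₂def]
    at hL'
  have h0a₁ := abs_nonneg (a₁ : ℝ)
  have h0a₂ := abs_nonneg (a₂ : ℝ)
  have h0b₁ := abs_nonneg ((b₁ : ℝ) / (N : ℝ))
  have h0b₂ := abs_nonneg ((b₂ : ℝ) / (N : ℝ))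
  have haL₁r : |(a₁ : ℝ)| ≤ L := by linarith
  have haL₂r : |(a₂ : ℝ)| ≤ L := by linarith
  have hbL₁r : |(b₁ : ℝ) / (N : ℝ)| ≤ L := by linarith
  have hbL₂r : |(b₂ : ℝ) / (N : ℝ)| ≤ L := by linarith
  have haL₁ : |a₁| ≤ (L : ℤ) := by exact_mod_cast haL₁r
  have haL₂ : |a₂| ≤ (L : ℤ) := by exact_mod_cast haL₂r
  have hbL₁ : |b₁| ≤ (L : ℤ) * (N : ℤ) := by
    rw [abs_div, abs_of_pos hNpos, div_le_iff₀ hNpos] at hbL₁r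
    exact_mod_cast hbL₁r
  have hbL₂ : |b₂| ≤ (L : ℤ) * (N : ℤ) := by
    rw [abs_div, abs_of_pos hNpos, div_le_iff₀ hNpos] at hbL₂r
    exact_mod_cast hbL₂r
  -- the crux's sum in coordinates
  have hsummand : ∀ m : ℤ,
      (∏ i : Fin 2, ((ArithmeticFunction.liouville (Int.toNat ((Ψ i).eval (fun _ : Fin 1 => m))) :
        ℤ) : ℝ)) = lam (a₁ * m + b₁) * lam (a₂ * m + b₂) := by
    intro m
    rw [Fin.prod_univ_two, eval_fin_one, eval_fin_one, ha₁def, hb₁def, ha₂def, hb₂def]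
    rfl
  rw [sum_latticeBox_one]
  simp only [hsummand]
  rcases interval_of_convex N K hK with hempty | ⟨u, v, hu, hv, hTeq⟩
  · rw [hempty, Finset.sum_empty, abs_zero]
    positivity
  rw [hTeq]
  rcases lt_or_gt_of_ne ha₁ with ha₁neg | ha₁pos
  · -- reflect `m ↦ -m`: the system `((-a₁) m + b₁, (-a₂) m + b₂)` on `[-v, -u]`
    rw [sum_Icc_reflect]
    have h := hN₀ N hN₀N (-a₁) b₁ (-a₂) b₂ (by linarith) (neg_ne_zero.mpr ha₂)
      (by linarith [(abs_le.mp haL₁).1]) (by rwa [abs_neg]) hbL₁ hbL₂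
      (fun h => hdet (by linear_combination (-1 : ℤ) * h)) (-v) (-u) (by linarith) (by linarith)
    simp only [neg_mul] at h
    simp only [mul_neg]
    exact h
  · exact hN₀ N hN₀N a₁ b₁ a₂ b₂ ha₁pos ha₂ (abs_le.mp haL₁).2 haL₂ hbL₁ hbL₂ hdet u v hu hv

/-- The crux by name, closed modulo the two registered stubs (checks that the `Sig.*` legend is the
stub signatures verbatim). -/
theorem chowlaNatural_of_stubs : ChowlaNatural :=
  ChowlaNatural_of stub_twinShape stub_goldbachShape

end Summit.Parity.GeneralizedHardyLittlewood.Cruxes.ChowlaNatural.Birth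

end
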